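import Summits.QuantumFields.GaugeBoot.EquipartitionDLR
import HarnessLib

/-!
# Gauge-boot: equipartition for SYMMETRIC DLR STATES plaquette by plaquette, and for the Wilson–Gibbs MEASURE of every
# finite periodic lattice `(A, e)` (tilted boxes included) (large-`N` supplement 19, part 10; WHAT REMAINS (lxxxiv), (lxxxv))

HONEST FRAMING (cell `pub-gaugeboot`, page 1 of every file): certified bounds on lattice
expectations at STATED coupling, gauge group, dimension and torus size; NOT a mass gap, NOT a
continuum limit, NOT a string tension, NOT large `N`; NOT Yang–Mills-summit-bearing (barriers
`FixedCouplingUltralocality`, `PerturbativeInvisibility`).  Analytic a-priori bounds; it certifies no number of CERTIFIED.md.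

## Content

* `evalR_expectationFunctional`, `evalC_expectationFunctional` — the lane's `evalR/evalC` of the expectation functional of a finite
  measure are the integrals (generic over `ι → G`);
* ★ `TiltedRP.sdPairF_expectation_of_sdPair` — on a finite periodic lattice the measure-level pair identity `SDPair` of the Wilson–Gibbs
  measure `gibbs r.ρ e β` is the functional-level row `SDPairF` of its expectation functional; hence ★★★
  `TiltedRP.Equipartition.sum_integral_plaquette_le_gibbs_suN` — **on EVERY finite periodic lattice `(A, e)` with `e ν ≠ 0` for all `ν`
  (the cubic torus of side `≥ 2`, the 45°-tilted boxes, …), `SU(N)`, `N ≥ 2`, `d ≥ 2`, `β ≥ 0`: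
  `Σ_{ν≠a, ε} ∫ (1/N)Re tr ρ(hol_x P̃_{ν,ε}) d(gibbs) ≤ 2(d−1)(1 − (N − 1/N)/(4(d−1)β + N − 1/N))`** — ADDENDUM 18's torus theorem for
  every periodic lattice at once;
* ★★★ `EquipartitionZd.integral_plaquette_le_of_symmetric_dlr` / `_std` — for every DLR state `μ ∈ 𝒢(β)` of `SU(N)` on `ℤ^d` which is
  invariant under translations and axis permutations (no reflection positivity, no Class-B structure needed) and EVERY plaquette:
  **`∫ u_{x;ij} dμ ≤ 1 − (N² − 1)/(4(d−1)β_std + N² − 1)`**; `integral_plaquetteObs_eq_of_symmetric` (all plaquettes have one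
  expectation).  (`ClassBState.integral_plaquette_le` of part 5 is the special case of a Class-B state: its fields
  `translationInvariant` and `permInvariant`, read through `configPerm_eq_configPermZd`, are exactly the two hypotheses.)
[folklore]
-/

noncomputable section

open MeasureTheory Filter Topology NormedSpace
open scoped Matrix
open Literature.Probability.LatticeModels (Site)
open Literature.MathematicalPhysics.QuantumFieldTheory (LatticeRep configPermZd)
open Literature.MathematicalPhysics.QuantumLattice (fundamentalLatticeRep fundamentalRep fundamentalLatticeRep_N LGConfig
  ZdEdge plaquetteObs ymGibbsMeasures IsZdTranslationInvariant continuous_fundamentalRep)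

namespace Summit.QuantumFields.GaugeBoot

/-! ## `evalR` / `evalC` of an expectation functional -/

section Expectation

variable {ι : Type*} [Countable ι] {G : Type*} [TopologicalSpace G] [CompactSpace G] [MeasurableSpace G] [BorelSpace G]
  [SecondCountableTopology G]

/-- `evalR (expectationFunctional μ) f = ∫ f dμ` for continuous `f`. [folklore] -/
theorem evalR_expectationFunctional (μ : Measure (ι → G)) [IsFiniteMeasure μ] {f : (ι → G) → ℝ} (hf : Continuous f) :
    evalR (expectationFunctional μ) f = ∫ U, f U ∂μ := by
  rw [evalR_eq _ hf, expectationFunctional_apply]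
  rfl

/-- `evalC (expectationFunctional μ) F = ∫ F dμ` for continuous `F`. [folklore] -/
theorem evalC_expectationFunctional (μ : Measure (ι → G)) [IsFiniteMeasure μ] {F : (ι → G) → ℂ} (hF : Continuous F) :
    evalC (expectationFunctional μ) F = ∫ U, F U ∂μ := by
  have hint : Integrable F μ := integrable_of_continuous_compact hF μ
  rw [evalC, evalR_expectationFunctional μ (f := fun U => (F U).re) (Complex.continuous_re.comp hF),
    evalR_expectationFunctional μ (f := fun U => (F U).im) (Complex.continuous_im.comp hF)]
  have h := integral_re_add_im hint
  simpa using h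

end Expectation

/-! ## Every finite periodic lattice: the Wilson–Gibbs measure -/

namespace TiltedRP

section Gibbs

variable {A : Type} [AddCommGroup A] [DecidableEq A] [Fintype A] {d : ℕ} {G : Type} [Group G] [TopologicalSpace G]
  [IsTopologicalGroup G] [CompactSpace G] [MeasurableSpace G] [BorelSpace G] [SecondCountableTopology G]
  (r : LatticeRep G) (e : Fin d → A)

/-- ★ **The measure-level pair identity of the Wilson–Gibbs measure of `(A, e)` is the functional-level row of its expectation
functional.** [folklore] -/
theorem sdPairF_expectation_of_sdPair {β : ℝ} {x : A} {μ : Fin d} {x₀ : A} {w : Word d} {X : Matrix (Fin r.N) (Fin r.N) ℂ}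
    [IsFiniteMeasure (gibbs (A := A) (G := G) r.ρ e β)] (h : SDPair r e β x μ x₀ w X) :
    SDPairF r e (expectationFunctional (gibbs (A := A) (G := G) r.ρ e β)) β x μ x₀ w X := fun Y => by
  rw [evalC_expectationFunctional _ (continuous_trace_mul_insDeriv r e Y X (x, μ) x₀ w),
    evalC_expectationFunctional _ (continuous_rhsIntegrand r e Y X x μ x₀ w)]
  exact h Y

end Gibbs

section GibbsSuN

variable {A : Type} [AddCommGroup A] [DecidableEq A] [Fintype A] {d N : ℕ} (e : Fin d → A)

/-- ★★★ **EQUIPARTITION ON EVERY FINITE PERIODIC LATTICE.**  `(A, e)` a finite periodic lattice with `e ν ≠ 0` for every `ν` (the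
cubic torus of side `≥ 2`, the 45°-tilted boxes of the cell, …), `SU(N)`, `N ≥ 2`, `d ≥ 2`, tree coupling `β ≥ 0`, `(x, a)` any link:
`Σ_{ν≠a, ε} ∫ (1/N) Re tr ρ(hol_x P̃_{ν,ε}) d(gibbs) ≤ 2(d−1)·(1 − (N − 1/N)/(4(d−1)β + N − 1/N))` — the `2(d−1)` plaquettes through
the link in the Wilson–Gibbs measure of the lattice. [folklore] -/
theorem Equipartition.sum_integral_plaquette_le_gibbs_suN (he : ∀ ν, e ν ≠ 0) (hN : 2 ≤ N) (hd : 2 ≤ d) {β : ℝ} (hβ : 0 ≤ β)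
    (x : A) (a : Fin d) :
    (∑ ν ∈ Finset.univ.erase a, ∑ ε : Bool,
        ∫ U, (N : ℝ)⁻¹ * (fundamentalRep (Fin N) (wordHolonomy e U x (plaqWord a ν ε))).trace.re
          ∂(gibbs (A := A) (fundamentalRep (Fin N)) e β)) ≤
      2 * ((d : ℝ) - 1) * (1 - ((N : ℝ) - 1 / N) / (4 * ((d : ℝ) - 1) * β + ((N : ℝ) - 1 / N))) := by
  haveI : SecondCountableTopology (Matrix (Fin N) (Fin N) ℂ) :=
    inferInstanceAs (SecondCountableTopology (Fin N → Fin N → ℂ))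
  haveI : SecondCountableTopology (Matrix.specialUnitaryGroup (Fin N) ℂ) :=
    Topology.IsEmbedding.subtypeVal.secondCountableTopology
  haveI : IsProbabilityMeasure (gibbs (A := A) (fundamentalLatticeRep N).ρ e β) :=
    isProbabilityMeasure_gibbs _ (fundamentalLatticeRep N).continuous e β
  set φ := expectationFunctional (gibbs (A := A) (fundamentalLatticeRep N).ρ e β) with hφ
  have hN2 : (1 : ℝ) < ((fundamentalLatticeRep N).N : ℝ) ^ 2 := by
    rw [fundamentalLatticeRep_N]
    have : (2 : ℝ) ≤ N := by exact_mod_cast hN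
    nlinarith
  have hP : ∀ ν ∈ Finset.univ.erase a, ∀ (ε : Bool) (i j : Fin (fundamentalLatticeRep N).N),
      SDPairF (fundamentalLatticeRep N) e φ β x a x (plaqWord a ν ε) (unitDir ((1 : ℝ) : ℂ) i j) := by
    intro ν _ ε i j
    rw [Complex.ofReal_one]
    exact sdPairF_expectation_of_sdPair (fundamentalLatticeRep N) e
      (sdPair_specialUnitaryGroup N e β x a x (plaqWord a ν ε) _ (trace_unitDir_one i j))
  have h := Equipartition.sum_evalR_plaquette_le_of_sdPairF (fundamentalLatticeRep N) e φ he hd hβ x a zero_le_one hN2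
    (n := 4) le_rfl (expectationFunctional_one _) (fun v _ => expectationFunctional_sq_nonneg _ v) hP
  have hev : ∀ ν ε, evalR φ (fun U => ((fundamentalLatticeRep N).N : ℝ)⁻¹ *
      ((fundamentalLatticeRep N).ρ (wordHolonomy e U x (plaqWord a ν ε))).trace.re) =
      ∫ U, (N : ℝ)⁻¹ * (fundamentalRep (Fin N) (wordHolonomy e U x (plaqWord a ν ε))).trace.re
        ∂(gibbs (A := A) (fundamentalRep (Fin N)) e β) := fun ν ε => by
    have hc : Continuous fun U : Config A d (Matrix.specialUnitaryGroup (Fin N) ℂ) => ((fundamentalLatticeRep N).N : ℝ)⁻¹ *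
        ((fundamentalLatticeRep N).ρ (wordHolonomy e U x (plaqWord a ν ε))).trace.re :=
      continuous_const.mul (Complex.continuous_re.comp
        ((fundamentalLatticeRep N).continuous.comp (continuous_wordHolonomy e x _)).matrix_trace)
    rw [hφ, evalR_expectationFunctional _ hc]
    rfl
  simp only [hev] at h
  simpa [fundamentalLatticeRep_N] using h

end GibbsSuN

end TiltedRP

/-! ## Symmetric DLR states on `ℤ^d`: every plaquette -/

namespace EquipartitionZd

open TiltedRP (zdUnit)

variable {d N : ℕ}

/-- ★ **In a translation- and axis-permutation-invariant state on `ℤ^d` every plaquette has one expectation.** [folklore] -/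
theorem integral_plaquetteObs_eq_of_symmetric {μ : Measure (LGConfig d (Matrix.specialUnitaryGroup (Fin N) ℂ))}
    (hT : IsZdTranslationInvariant μ)
    (hperm : ∀ π : Equiv.Perm (Fin d), μ.map (configPermZd (G := Matrix.specialUnitaryGroup (Fin N) ℂ) π) = μ)
    (x : Site d) {i j a b : Fin d} (hij : i ≠ j) (hab : a ≠ b) (c : ℝ) :
    ∫ U, c * plaquetteObs (fundamentalRep (Fin N)) x a b U ∂μ = ∫ U, c * plaquetteObs (fundamentalRep (Fin N)) 0 i j U ∂μ := by
  have h1 := integral_plaquetteObs_sub_eq_of_translationInvariant (fundamentalRep (Fin N)) hT 0 (-x) a b c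
  rw [zero_sub, neg_neg] at h1
  rw [h1, integral_const_mul, integral_const_mul, integral_plaquetteObs_zero_eq_of_map_configPermZd (fundamentalRep (Fin N)) hperm hij hab]

/-- ★★★ **EQUIPARTITION FOR SYMMETRIC GIBBS STATES, EVERY PLAQUETTE.**  `SU(N)` on `ℤ^d`, `N ≥ 2`, `d ≥ 2`, tree coupling
`β ≥ 0`; `μ ∈ 𝒢(β)` a DLR state invariant under translations and axis permutations (e.g. every Class-B state, every fully
symmetric Gibbs state of `exists_fullySymmetric_dlr_suN`): for every plaquette `(x; i ≠ j)`,
`∫ (1/N) Re tr U_{x;ij} dμ ≤ 1 − (N − 1/N)/(4(d−1)β + N − 1/N)`. [folklore] -/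
theorem integral_plaquette_le_of_symmetric_dlr (hN : 2 ≤ N) (hd : 2 ≤ d) {β : ℝ} (hβ : 0 ≤ β)
    {μ : Measure (LGConfig d (Matrix.specialUnitaryGroup (Fin N) ℂ))}
    (hμ : μ ∈ ymGibbsMeasures (d := d) (fundamentalRep (Fin N)) β) (hT : IsZdTranslationInvariant μ)
    (hperm : ∀ π : Equiv.Perm (Fin d), μ.map (configPermZd (G := Matrix.specialUnitaryGroup (Fin N) ℂ) π) = μ)
    (x : Site d) {i j : Fin d} (hij : i ≠ j) :
    ∫ U, (N : ℝ)⁻¹ * plaquetteObs (fundamentalRep (Fin N)) x i j U ∂μ ≤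
      1 - ((N : ℝ) - 1 / N) / (4 * ((d : ℝ) - 1) * β + ((N : ℝ) - 1 / N)) := by
  have h := sum_integral_plaquette_le_of_mem_ymGibbsMeasures hN hd hβ hμ x i
  have hterm : ∀ ν ∈ Finset.univ.erase i,
      (∫ U, (N : ℝ)⁻¹ * plaquetteObs (fundamentalRep (Fin N)) x i ν U ∂μ +
        ∫ U, (N : ℝ)⁻¹ * plaquetteObs (fundamentalRep (Fin N)) (x - zdUnit d ν) i ν U ∂μ) =
      2 * ∫ U, (N : ℝ)⁻¹ * plaquetteObs (fundamentalRep (Fin N)) x i j U ∂μ := by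
    intro ν hν
    have hiν : i ≠ ν := (Finset.ne_of_mem_erase hν).symm
    rw [integral_plaquetteObs_eq_of_symmetric hT hperm x hij hiν, integral_plaquetteObs_eq_of_symmetric hT hperm (x - zdUnit d ν) hij hiν,
      integral_plaquetteObs_eq_of_symmetric hT hperm x hij hij]
    ring
  rw [Finset.sum_congr rfl hterm, Finset.sum_const, Finset.card_erase_of_mem (Finset.mem_univ i), Finset.card_univ,
    Fintype.card_fin, nsmul_eq_mul, Nat.cast_sub (by omega : 1 ≤ d), Nat.cast_one, linkBound_eq] at h
  have hd0 : (0 : ℝ) < (d : ℝ) - 1 := by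
    have : (2 : ℝ) ≤ d := by exact_mod_cast hd
    linarith
  nlinarith [h]

/-- **Cell normalisation**: for a symmetric DLR state at `β_std/N`, `∫ u_P dμ ≤ 1 − (N² − 1)/(4(d−1)β_std + N² − 1)` for every
plaquette. [folklore] -/
theorem integral_plaquette_le_of_symmetric_dlr_std (hN : 2 ≤ N) (hd : 2 ≤ d) {β : ℝ} (hβ : 0 ≤ β)
    {μ : Measure (LGConfig d (Matrix.specialUnitaryGroup (Fin N) ℂ))}
    (hμ : μ ∈ ymGibbsMeasures (d := d) (fundamentalRep (Fin N)) (β / N)) (hT : IsZdTranslationInvariant μ)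
    (hperm : ∀ π : Equiv.Perm (Fin d), μ.map (configPermZd (G := Matrix.specialUnitaryGroup (Fin N) ℂ) π) = μ)
    (x : Site d) {i j : Fin d} (hij : i ≠ j) :
    ∫ U, (N : ℝ)⁻¹ * plaquetteObs (fundamentalRep (Fin N)) x i j U ∂μ ≤
      1 - ((N : ℝ) ^ 2 - 1) / (4 * ((d : ℝ) - 1) * β + ((N : ℝ) ^ 2 - 1)) := by
  have hN0 : (0 : ℝ) < N := by exact_mod_cast (by omega : 0 < N)
  have h := integral_plaquette_le_of_symmetric_dlr hN hd (div_nonneg hβ hN0.le) hμ hT hperm x hij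
  have hb := linkBound_div (d := d) hN hd hβ
  rw [linkBound_eq] at hb
  have hd0 : (0 : ℝ) < 2 * ((d : ℝ) - 1) := by
    have : (2 : ℝ) ≤ d := by exact_mod_cast hd
    linarith
  have hb' := mul_left_cancel₀ hd0.ne' hb
  linarith [hb']

end EquipartitionZd

end Summit.QuantumFields.GaugeBoot

end
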